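import Summits.CriticalPhenomena.CardyFormulaZ2.Theorems.CardyBoundaryCoulombGasHalfPlaneMarkDensityLawEquivalence
import Summits.CriticalPhenomena.CardyFormulaZ2.Theorems.CardyBoundaryCoulombGasHalfPlaneMarkDensityLawFromRectilinear
import Summits.CriticalPhenomena.CardyFormulaZ2.Theorems.CardyBoundaryCoulombGasHalfPlaneMarkDensityLawBoxExhaustionPart3
import Summits.CriticalPhenomena.CardyFormulaZ2.Theorems.CardyBoundaryCoulombGasHalfPlaneMarkDensityLawBoxExhaustionPart5
import Summits.CriticalPhenomena.CardyFormulaZ2.Theses.CardyTotalPositivity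

/-!
# Line `Sketch` — the open stub C⁺ implies the wired 3-mark half-plane Cardy law
# (`HalfPlaneWiredCardy`, stmt-CriticalPhenomena-9321, the rank-0 target of route CardyTotalPositivity)

For `σ, x > 0` the wired event `{(−∞, −⌊σn⌋] × {0} ↔ [1, ⌊xn⌋] × {0} in ℤ × ℕ}` is sandwiched between
collinear four-mark events of C⁺:

* from below by `[−Mn, ⌊−σn⌋] ↔ [⌊n/M⌋, ⌊xn⌋]` (arc inclusion), whose probability tends to
  `F(η(−M, −σ, 1/M, x))` by C⁺;
* from above by `[−Mn, ⌊(−σ+1/M)n⌋] ↔ [0, ⌊xn⌋]` together with the ESCAPE event "some site of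
  `Λ_{⌈x⌉n}` is joined to a site outside `Λ_{Mn}`", of probability `≤ C (⌈x⌉/M)^α` by the tree's RSW
  one-arm power bound `exists_real_boxToFar_le_rpow_of_le_half`; the first tends to
  `F(η(−M, −σ+1/M, 0, x))` by C⁺.

Both cross-ratios tend to `x/(x+σ)` as `M → ∞` (closed forms in `u = 1/M`), `F` is continuous on
`(0,1)`, and the `ε`-sandwich `tendsto_of_sandwich` concludes.  Corollaries BY NAME:
`HalfPlaneMarkDensityLaw → HalfPlaneWiredCardy` (crux 5 of CardyBoundaryCoulombGas implies the target
of CardyTotalPositivity), `RectilinearCardy → HalfPlaneWiredCardy`, `CardyFormulaZ2 → HalfPlaneWiredCardy`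
(the target stmt-9321 is NECESSARY for the conjunct).
-/

noncomputable section

namespace Summit.CriticalPhenomena.CardyFormulaZ2.Cruxes.HalfPlaneMarkDensityLaw.SketchLine

open Literature.Probability.Percolation Literature.Probability.LatticeModels
open Literature.Probability.RandomPlanarGeometry
open MeasureTheory Filter Set
open scoped Topology
open Summit.CriticalPhenomena.CardyFormulaZ2.Theses.CardyBoundaryCoulombGas
  (HalfPlaneMarkDensityLaw RectilinearCardy)
open Summit.CriticalPhenomena.CardyFormulaZ2.Theses.CardyTotalPositivity (HalfPlaneWiredCardy)
open Summit.CriticalPhenomena.CardyFormulaZ2.Theorems.HalfPlaneMarkDensityLaw.Negative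

namespace WiredCardy

variable {σ x : ℝ}

/-! ## Cross-ratio asymptotics -/

/-- Closed form of `η(−M, −σ, 1/M, x)` in `u = 1/M`. [folklore] -/
theorem crossRatio_lo (hσ : 0 < σ) (hx : 0 < x) {M : ℕ} (hM : 0 < M) :
    crossRatio ![-(M : ℝ), -σ, (M : ℝ)⁻¹, x] =
      (1 - σ * (M : ℝ)⁻¹) * (x - (M : ℝ)⁻¹) / ((1 + ((M : ℝ)⁻¹) ^ 2) * (σ + x)) := by
  rw [crossRatio_four]
  have hM' : (0 : ℝ) < M := by exact_mod_cast hM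
  have hD1 : (-(M : ℝ) - (M : ℝ)⁻¹) * (-σ - x) ≠ 0 := by
    have : 0 < (M : ℝ) + (M : ℝ)⁻¹ := by positivity
    have h' : (-(M : ℝ) - (M : ℝ)⁻¹) * (-σ - x) = ((M : ℝ) + (M : ℝ)⁻¹) * (σ + x) := by ring
    rw [h']; positivity
  have hD2 : (1 + ((M : ℝ)⁻¹) ^ 2) * (σ + x) ≠ 0 := by positivity
  rw [div_eq_div_iff hD1 hD2]
  field_simp
  ring

/-- Closed form of `η(−M, −σ + 1/M, 0, x)` in `u = 1/M`. [folklore] -/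
theorem crossRatio_hi (hx : 0 < x) {M : ℕ} (hM : 0 < M) (hMσ : (M : ℝ)⁻¹ < σ) :
    crossRatio ![-(M : ℝ), -σ + (M : ℝ)⁻¹, 0, x] =
      x * (1 - σ * (M : ℝ)⁻¹ + ((M : ℝ)⁻¹) ^ 2) / (σ + x - (M : ℝ)⁻¹) := by
  rw [crossRatio_four]
  have hM' : (0 : ℝ) < M := by exact_mod_cast hM
  have hD1 : (-(M : ℝ) - 0) * (-σ + (M : ℝ)⁻¹ - x) ≠ 0 := by
    have h' : (-(M : ℝ) - 0) * (-σ + (M : ℝ)⁻¹ - x) = (M : ℝ) * (σ + x - (M : ℝ)⁻¹) := by ring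
    rw [h']
    exact mul_ne_zero hM'.ne' (by linarith)
  have hD2 : σ + x - (M : ℝ)⁻¹ ≠ 0 := by linarith
  rw [div_eq_div_iff hD1 hD2]
  field_simp
  ring

/-- The lower closed form is continuous at `u = 0`. [folklore] -/
theorem continuousAt_Φlo (hσ : 0 < σ) (hx : 0 < x) :
    ContinuousAt (fun u : ℝ ↦ (1 - σ * u) * (x - u) / ((1 + u ^ 2) * (σ + x))) 0 := by
  refine ContinuousAt.div (by fun_prop) (by fun_prop) ?_
  positivity

/-- The upper closed form is continuous at `u = 0`. [folklore] -/
theorem continuousAt_Φhi (hσ : 0 < σ) (hx : 0 < x) :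
    ContinuousAt (fun u : ℝ ↦ x * (1 - σ * u + u ^ 2) / (σ + x - u)) 0 := by
  refine ContinuousAt.div (by fun_prop) (by fun_prop) ?_
  simp only [sub_zero]; positivity

/-- The lower closed form at `u = 0` is `x/(x+σ)`. [folklore] -/
theorem Φlo_zero (σ x : ℝ) : (fun u : ℝ ↦ (1 - σ * u) * (x - u) / ((1 + u ^ 2) * (σ + x))) 0 = x / (x + σ) := by
  simp [add_comm]

/-- The upper closed form at `u = 0` is `x/(x+σ)`. [folklore] -/
theorem Φhi_zero (σ x : ℝ) : (fun u : ℝ ↦ x * (1 - σ * u + u ^ 2) / (σ + x - u)) 0 = x / (x + σ) := by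
  simp [add_comm]

/-- `x/(x+σ) ∈ (0,1)`. [folklore] -/
theorem ratio_mem_Ioo (hσ : 0 < σ) (hx : 0 < x) : x / (x + σ) ∈ Ioo (0 : ℝ) 1 :=
  ⟨by positivity, (div_lt_one (by positivity)).2 (by linarith)⟩

/-- `F` is continuous at `x/(x+σ)`. [folklore] -/
theorem continuousAt_cardy_ratio (hσ : 0 < σ) (hx : 0 < x) :
    ContinuousAt Literature.Probability.RandomPlanarGeometry.cardyFunction (x / (x + σ)) :=
  continuousOn_cardyFunction_Ioo.continuousAt (Ioo_mem_nhds (ratio_mem_Ioo hσ hx).1 (ratio_mem_Ioo hσ hx).2)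

/-- `F(η(−M, −σ, 1/M, x)) → F(x/(x+σ))` as `M → ∞`. [folklore] -/
theorem tendsto_cardy_lo (hσ : 0 < σ) (hx : 0 < x) :
    Tendsto (fun M : ℕ ↦ Literature.Probability.RandomPlanarGeometry.cardyFunction (crossRatio ![-(M : ℝ), -σ, (M : ℝ)⁻¹, x])) atTop
      (𝓝 (Literature.Probability.RandomPlanarGeometry.cardyFunction (x / (x + σ)))) := by
  have h1 : Tendsto (fun M : ℕ ↦ (fun u : ℝ ↦ (1 - σ * u) * (x - u) / ((1 + u ^ 2) * (σ + x))) (M : ℝ)⁻¹) atTop (𝓝 (x / (x + σ))) := by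
    rw [← Φlo_zero σ x]
    exact (continuousAt_Φlo hσ hx).tendsto.comp tendsto_inv_atTop_nhds_zero_nat
  have h2 := (continuousAt_cardy_ratio hσ hx).tendsto.comp h1
  refine h2.congr' ?_
  filter_upwards [eventually_gt_atTop 0] with M hM
  simp only [Function.comp_apply]
  rw [crossRatio_lo hσ hx hM]

/-- `F(η(−M, −σ + 1/M, 0, x)) → F(x/(x+σ))` as `M → ∞`. [folklore] -/
theorem tendsto_cardy_hi (hσ : 0 < σ) (hx : 0 < x) :
    Tendsto (fun M : ℕ ↦ Literature.Probability.RandomPlanarGeometry.cardyFunction (crossRatio ![-(M : ℝ), -σ + (M : ℝ)⁻¹, 0, x])) atTop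
      (𝓝 (Literature.Probability.RandomPlanarGeometry.cardyFunction (x / (x + σ)))) := by
  have h1 : Tendsto (fun M : ℕ ↦ (fun u : ℝ ↦ x * (1 - σ * u + u ^ 2) / (σ + x - u)) (M : ℝ)⁻¹) atTop (𝓝 (x / (x + σ))) := by
    rw [← Φhi_zero σ x]
    exact (continuousAt_Φhi hσ hx).tendsto.comp tendsto_inv_atTop_nhds_zero_nat
  have h2 := (continuousAt_cardy_ratio hσ hx).tendsto.comp h1
  have hev : ∀ᶠ M : ℕ in atTop, (M : ℝ)⁻¹ < σ :=
    (tendsto_inv_atTop_nhds_zero_nat (𝕜 := ℝ)) (Iio_mem_nhds hσ)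
  refine h2.congr' ?_
  filter_upwards [eventually_gt_atTop 0, hev] with M hM hMσ
  simp only [Function.comp_apply]
  rw [crossRatio_hi hx hM hMσ]

/-- The escape bound `C (X/M)^α → 0` as `M → ∞`. [folklore] -/
theorem tendsto_escapeBound (C : ℝ) {α : ℝ} (hα : 0 < α) (X : ℕ) :
    Tendsto (fun M : ℕ ↦ C * ((X : ℝ) / M) ^ α) atTop (𝓝 0) := by
  have h1 : Tendsto (fun M : ℕ ↦ (X : ℝ) / M) atTop (𝓝 0) := tendsto_const_div_atTop_nhds_zero_nat _
  have h2 : Tendsto (fun M : ℕ ↦ ((X : ℝ) / M) ^ α) atTop (𝓝 ((0 : ℝ) ^ α)) :=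
    (Real.continuousAt_rpow_const 0 α (Or.inr hα.le)).tendsto.comp h1
  rw [Real.zero_rpow hα.ne'] at h2
  simpa using h2.const_mul C

/-! ## Lattice inclusions -/

/-- `⌊−σn⌋ ≤ −⌊σn⌋`. [folklore] -/
theorem floor_neg_mul_le (σ : ℝ) (n : ℕ) : ⌊(-σ) * (n : ℝ)⌋ ≤ -⌊σ * (n : ℝ)⌋ := by
  rw [neg_mul, Int.floor_neg, neg_le_neg_iff]
  exact Int.floor_le_ceil _

/-- LOWER inclusion: `[⌊−Mn⌋, ⌊−σn⌋] ↔ [⌊n/M⌋, ⌊xn⌋]` implies the wired event, once `n ≥ M`. [folklore] -/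
theorem lower_subset (σ x : ℝ) {M n : ℕ} (hM : 0 < M) (hn : M ≤ n) :
    openCrossing halfPlane (arcA (-(M : ℝ)) (-σ) n) (rowIcc ⌊(M : ℝ)⁻¹ * n⌋ ⌊x * n⌋) ⊆
      openCrossing halfPlane {v : Site 2 | v 1 = 0 ∧ v 0 ≤ -⌊σ * n⌋}
        {v : Site 2 | v 1 = 0 ∧ 1 ≤ v 0 ∧ v 0 ≤ ⌊x * n⌋} := by
  refine openCrossing_mono subset_rfl ?_ ?_
  · rintro v ⟨hv1, -, hv0⟩
    exact ⟨hv1, hv0.trans (floor_neg_mul_le σ n)⟩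
  · rintro v ⟨hv1, hv0, hv0'⟩
    refine ⟨hv1, le_trans ?_ hv0, hv0'⟩
    rw [Int.le_floor]
    have hM' : (0 : ℝ) < M := by exact_mod_cast hM
    have hn' : (M : ℝ) ≤ n := by exact_mod_cast hn
    rw [Int.cast_one, inv_mul_eq_div, le_div_iff₀ hM']
    linarith

/-- `⌊(−M)·n⌋ = −Mn` for naturals `M, n`. [folklore] -/
theorem floor_neg_natCast_mul (M n : ℕ) : ⌊(-(M : ℝ)) * (n : ℝ)⌋ = -((M : ℤ) * n) := by
  have : (-(M : ℝ)) * (n : ℝ) = ((-((M : ℤ) * n) : ℤ) : ℝ) := by push_cast; ring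
  rw [this, Int.floor_intCast]

/-- Splitting the wired arc: `arcL ⊆ arcFar ∪ [⌊−Mn⌋, ⌊(−σ+1/M)n⌋]`, once `n ≥ M`. [folklore] -/
theorem arcL_subset (σ : ℝ) {M n : ℕ} (hM : 0 < M) (hn : M ≤ n) :
    {v : Site 2 | v 1 = 0 ∧ v 0 ≤ -⌊σ * n⌋} ⊆
      {v : Site 2 | v 1 = 0 ∧ v 0 < -((M : ℤ) * n)} ∪ arcA (-(M : ℝ)) (-σ + (M : ℝ)⁻¹) n := by
  rintro v ⟨hv1, hv0⟩
  by_cases h : v 0 < -((M : ℤ) * n)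
  · exact Or.inl ⟨hv1, h⟩
  · refine Or.inr ⟨hv1, ?_, ?_⟩
    · rw [floor_neg_natCast_mul]; exact not_lt.1 h
    · refine hv0.trans ?_
      rw [Int.le_floor]
      have hM' : (0 : ℝ) < M := by exact_mod_cast hM
      have hn' : (M : ℝ) ≤ n := by exact_mod_cast hn
      have h1 : (σ * n : ℝ) < ⌊σ * (n : ℝ)⌋ + 1 := Int.lt_floor_add_one _
      have h2 : (1 : ℝ) ≤ (M : ℝ)⁻¹ * n := by
        rw [inv_mul_eq_div, le_div_iff₀ hM']; linarith
      push_cast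
      nlinarith

/-- `arcR ⊆ [⌊0·n⌋, ⌊xn⌋]`. [folklore] -/
theorem arcR_subset (x : ℝ) (n : ℕ) :
    {v : Site 2 | v 1 = 0 ∧ 1 ≤ v 0 ∧ v 0 ≤ ⌊x * n⌋} ⊆ rowIcc ⌊(0 : ℝ) * n⌋ ⌊x * n⌋ := by
  rintro v ⟨hv1, hv0, hv0'⟩
  refine ⟨hv1, ?_, hv0'⟩
  rw [zero_mul, Int.floor_zero]; omega

/-- Crossing events split along a union of source arcs. [folklore] -/
theorem openCrossing_union_left (S A A' B : Set (Site 2)) :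
    openCrossing S (A ∪ A') B ⊆ openCrossing S A B ∪ openCrossing S A' B := by
  rintro ω ⟨p, hp | hp, q, hq, h⟩
  · exact Or.inl ⟨p, hp, q, hq, h⟩
  · exact Or.inr ⟨p, hp, q, hq, h⟩

/-- The far part of the wired event is an ESCAPE from `Λ_{⌈x⌉n}` to outside `Λ_{Mn}`. [folklore] -/
theorem far_subset_escape (x : ℝ) (M n : ℕ) :
    openCrossing halfPlane {v : Site 2 | v 1 = 0 ∧ v 0 < -((M : ℤ) * n)}
        {v : Site 2 | v 1 = 0 ∧ 1 ≤ v 0 ∧ v 0 ≤ ⌊x * n⌋} ⊆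
      {ω | ∃ p ∈ box 2 (⌈x⌉₊ * n), ∃ q ∉ box 2 (M * n), ω ∈ openConnIn univ p q} := by
  rintro ω ⟨p, ⟨-, hp0⟩, q, ⟨hq1, hq0, hq0'⟩, h⟩
  refine ⟨q, ?_, p, ?_, ?_⟩
  · rw [mem_box]
    intro i
    fin_cases i
    · constructor
      · have h0 : (0 : ℤ) ≤ (⌈x⌉₊ : ℤ) * n := by positivity
        simp only [Fin.zero_eta, Fin.isValue]; push_cast; omega
      · have h1 : ((⌊x * (n : ℝ)⌋ : ℤ) : ℝ) ≤ x * n := Int.floor_le _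
        have h2 : x * n ≤ (⌈x⌉₊ : ℝ) * n :=
          mul_le_mul_of_nonneg_right (Nat.le_ceil x) (Nat.cast_nonneg n)
        have h3 : ((⌊x * (n : ℝ)⌋ : ℤ) : ℝ) ≤ ((((⌈x⌉₊ * n : ℕ)) : ℤ) : ℝ) := by
          push_cast; linarith
        have h4 : (⌊x * (n : ℝ)⌋ : ℤ) ≤ ((⌈x⌉₊ * n : ℕ) : ℤ) := by exact_mod_cast h3
        simp only [Fin.zero_eta, Fin.isValue]
        exact hq0'.trans h4
    · simp only [Fin.mk_one, Fin.isValue]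
      rw [hq1]; exact ⟨neg_nonpos.2 (by positivity), by positivity⟩
  · rw [mem_box, not_forall]
    refine ⟨0, fun hh ↦ ?_⟩
    have := hh.1
    push_cast at this
    omega
  · rw [openConnIn_comm]
    exact openConnIn_mono (subset_univ _) _ _ h

/-- UPPER bound at fixed `M ≤ n`: wired ≤ collinear four-mark probability + escape probability. [folklore] -/
theorem wired_le (σ x : ℝ) {M n : ℕ} (hM : 0 < M) (hn : M ≤ n) :
    μ.real (openCrossing halfPlane {v : Site 2 | v 1 = 0 ∧ v 0 ≤ -⌊σ * n⌋}
        {v : Site 2 | v 1 = 0 ∧ 1 ≤ v 0 ∧ v 0 ≤ ⌊x * n⌋}) ≤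
      μ.real (openCrossing halfPlane (arcA (-(M : ℝ)) (-σ + (M : ℝ)⁻¹) n) (rowIcc ⌊(0 : ℝ) * n⌋ ⌊x * n⌋)) +
        μ.real {ω | ∃ p ∈ box 2 (⌈x⌉₊ * n), ∃ q ∉ box 2 (M * n), ω ∈ openConnIn univ p q} := by
  have h1 : openCrossing halfPlane {v : Site 2 | v 1 = 0 ∧ v 0 ≤ -⌊σ * n⌋}
        {v : Site 2 | v 1 = 0 ∧ 1 ≤ v 0 ∧ v 0 ≤ ⌊x * n⌋} ⊆
      openCrossing halfPlane (arcA (-(M : ℝ)) (-σ + (M : ℝ)⁻¹) n) (rowIcc ⌊(0 : ℝ) * n⌋ ⌊x * n⌋) ∪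
        {ω | ∃ p ∈ box 2 (⌈x⌉₊ * n), ∃ q ∉ box 2 (M * n), ω ∈ openConnIn univ p q} := by
    intro ω hω
    have hω' := openCrossing_mono (subset_rfl) (arcL_subset σ hM hn) subset_rfl hω
    rcases openCrossing_union_left _ _ _ _ hω' with h | h
    · exact Or.inr (far_subset_escape x M n h)
    · exact Or.inl (openCrossing_mono subset_rfl subset_rfl (arcR_subset x n) h)
  calc μ.real (openCrossing halfPlane {v : Site 2 | v 1 = 0 ∧ v 0 ≤ -⌊σ * n⌋}
        {v : Site 2 | v 1 = 0 ∧ 1 ≤ v 0 ∧ v 0 ≤ ⌊x * n⌋}) ≤ μ.real (openCrossing halfPlane (arcA (-(M : ℝ)) (-σ + (M : ℝ)⁻¹) n)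
          (rowIcc ⌊(0 : ℝ) * n⌋ ⌊x * n⌋) ∪
        {ω | ∃ p ∈ box 2 (⌈x⌉₊ * n), ∃ q ∉ box 2 (M * n), ω ∈ openConnIn univ p q}) :=
        measureReal_mono h1 (measure_ne_top _ _)
    _ ≤ _ := measureReal_union_le _ _

/-- LOWER bound at fixed `M ≤ n`. [folklore] -/
theorem le_wired (σ x : ℝ) {M n : ℕ} (hM : 0 < M) (hn : M ≤ n) :
    μ.real (openCrossing halfPlane (arcA (-(M : ℝ)) (-σ) n) (rowIcc ⌊(M : ℝ)⁻¹ * n⌋ ⌊x * n⌋)) ≤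
      μ.real (openCrossing halfPlane {v : Site 2 | v 1 = 0 ∧ v 0 ≤ -⌊σ * n⌋}
        {v : Site 2 | v 1 = 0 ∧ 1 ≤ v 0 ∧ v 0 ≤ ⌊x * n⌋}) :=
  measureReal_mono (lower_subset σ x hM hn) (measure_ne_top _ _)

/-- The escape probability at scales `⌈x⌉ n ≤ M n`. [folklore] -/
theorem escape_le' {C α : ℝ}
    (hesc : ∀ p : unitInterval, (p : ℝ) ≤ 1 / 2 → ∀ r R : ℕ, 1 ≤ r → r ≤ R →
      (bondPercolation (zdGraph 2) p).real
        {ω | ∃ x ∈ box 2 r, ∃ y ∉ box 2 R, ω ∈ openConnIn Set.univ x y} ≤ C * ((r : ℝ) / R) ^ α)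
    (x : ℝ) {M n : ℕ} (hX : 1 ≤ ⌈x⌉₊) (hXM : ⌈x⌉₊ ≤ M) (hn : 1 ≤ n) :
    μ.real {ω | ∃ p ∈ box 2 (⌈x⌉₊ * n), ∃ q ∉ box 2 (M * n), ω ∈ openConnIn univ p q} ≤
      C * ((⌈x⌉₊ : ℝ) / M) ^ α := by
  have h := hesc half (by simp) (⌈x⌉₊ * n) (M * n) (Nat.one_le_iff_ne_zero.2 (by positivity))
    (Nat.mul_le_mul_right _ hXM)
  have hn' : ((n : ℕ) : ℝ) ≠ 0 := by positivity
  have e : (((⌈x⌉₊ * n : ℕ) : ℝ) / ((M * n : ℕ) : ℝ)) = (⌈x⌉₊ : ℝ) / M := by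
    rw [Nat.cast_mul, Nat.cast_mul, mul_div_mul_right _ _ hn']
  rw [e] at h
  exact h

/-! ## The sandwich -/

/-- **C⁺ ⇒ wired 3-mark half-plane Cardy** (in the line's vocabulary). [folklore] -/
theorem tendsto_wired
    (hC : ∀ a b c y : ℝ, a < b → b < c → c < y →
      Tendsto (fun n : ℕ ↦ μ.real (openCrossing halfPlane (arcA a b n) (rowIcc ⌊c * n⌋ ⌊y * n⌋))) atTop
        (𝓝 (Literature.Probability.RandomPlanarGeometry.cardyFunction (crossRatio ![a, b, c, y]))))
    (hσ : 0 < σ) (hx : 0 < x) :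
    Tendsto (fun n : ℕ ↦ μ.real (openCrossing halfPlane {v : Site 2 | v 1 = 0 ∧ v 0 ≤ -⌊σ * n⌋}
        {v : Site 2 | v 1 = 0 ∧ 1 ≤ v 0 ∧ v 0 ≤ ⌊x * n⌋})) atTop (𝓝 (Literature.Probability.RandomPlanarGeometry.cardyFunction (x / (x + σ)))) := by
  obtain ⟨C, α, hC0, hα, hesc⟩ := exists_real_boxToFar_le_rpow_of_le_half
  set L := Literature.Probability.RandomPlanarGeometry.cardyFunction (x / (x + σ)) with hL
  have hX : 1 ≤ ⌈x⌉₊ := Nat.one_le_iff_ne_zero.2 (by simpa using hx)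
  refine BoxExhaustion.tendsto_of_sandwich fun ε hε ↦ ?_
  -- choose M
  have e1 : ∀ᶠ M : ℕ in atTop, L - ε < Literature.Probability.RandomPlanarGeometry.cardyFunction (crossRatio ![-(M : ℝ), -σ, (M : ℝ)⁻¹, x]) :=
    (tendsto_cardy_lo hσ hx) (Ioi_mem_nhds (by linarith))
  have e2 : ∀ᶠ M : ℕ in atTop, Literature.Probability.RandomPlanarGeometry.cardyFunction (crossRatio ![-(M : ℝ), -σ + (M : ℝ)⁻¹, 0, x]) < L + ε :=
    (tendsto_cardy_hi hσ hx) (Iio_mem_nhds (by linarith))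
  have e3 : ∀ᶠ M : ℕ in atTop, C * ((⌈x⌉₊ : ℝ) / M) ^ α < ε :=
    (tendsto_escapeBound C hα ⌈x⌉₊) (Iio_mem_nhds hε)
  have e4 : ∀ᶠ M : ℕ in atTop, (M : ℝ)⁻¹ < min σ x :=
    (tendsto_inv_atTop_nhds_zero_nat (𝕜 := ℝ)) (Iio_mem_nhds (lt_min hσ hx))
  have e5 : ∀ᶠ M : ℕ in atTop, σ < M := (tendsto_natCast_atTop_atTop (R := ℝ)).eventually_gt_atTop σ
  obtain ⟨M, hM1, hM2, hM3, hM4, hM5, hMX⟩ :=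
    (e1.and (e2.and (e3.and (e4.and (e5.and (eventually_ge_atTop ⌈x⌉₊)))))).exists
  have hM : 0 < M := lt_of_lt_of_le (by omega) hMX
  have hM' : (0 : ℝ) < M := by exact_mod_cast hM
  have hMσ : (M : ℝ)⁻¹ < σ := lt_of_lt_of_le hM4 (min_le_left _ _)
  have hMx : (M : ℝ)⁻¹ < x := lt_of_lt_of_le hM4 (min_le_right _ _)
  refine ⟨fun n ↦ μ.real (openCrossing halfPlane (arcA (-(M : ℝ)) (-σ) n) (rowIcc ⌊(M : ℝ)⁻¹ * n⌋ ⌊x * n⌋)),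
    fun n ↦ μ.real (openCrossing halfPlane (arcA (-(M : ℝ)) (-σ + (M : ℝ)⁻¹) n)
      (rowIcc ⌊(0 : ℝ) * n⌋ ⌊x * n⌋)), _, _,
    hC _ _ _ _ (by linarith) (by linarith [inv_pos.2 hM']) hMx,
    hC _ _ _ _ (by linarith [inv_pos.2 hM']) (by linarith) hx, hM1, hM2, ?_⟩
  filter_upwards [eventually_ge_atTop (max M 1)] with n hn
  have hnM : M ≤ n := le_of_max_le_left hn
  have hn1 : 1 ≤ n := le_of_max_le_right hn
  refine ⟨le_wired σ x hM hnM, (wired_le σ x hM hnM).trans ?_⟩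
  have := escape_le' hesc x hX hMX hn1
  linarith

end WiredCardy

/-- **C⁺ ⇒ `HalfPlaneWiredCardy`**: the collinear four-mark half-plane Cardy law for bond-`ℤ²`
implies the wired three-mark law (stmt-CriticalPhenomena-9321, target of route CardyTotalPositivity).
[folklore] -/
theorem halfPlaneWiredCardy_of_collinearCardy
    (hC : ∀ a b c y : ℝ, a < b → b < c → c < y →
      Tendsto (fun n : ℕ ↦ μ.real (openCrossing halfPlane (arcA a b n) (rowIcc ⌊c * n⌋ ⌊y * n⌋))) atTop
        (𝓝 (Literature.Probability.RandomPlanarGeometry.cardyFunction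
          (Literature.Probability.RandomPlanarGeometry.crossRatio ![a, b, c, y])))) :
    HalfPlaneWiredCardy :=
  fun _σ _x hσ hx ↦ WiredCardy.tendsto_wired hC hσ hx

/-- **Crux 5 ⇒ target 9321**: `HalfPlaneMarkDensityLaw → HalfPlaneWiredCardy` (registered extra stub
of line `Sketch`). [folklore] -/
theorem halfPlaneWiredCardy_of_halfPlaneMarkDensityLaw : HalfPlaneMarkDensityLaw → HalfPlaneWiredCardy :=
  fun h ↦ halfPlaneWiredCardy_of_collinearCardy (stub_converse h)

/-- **Crux 4 ⇒ target 9321**: `RectilinearCardy → HalfPlaneWiredCardy`. [folklore] -/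
theorem halfPlaneWiredCardy_of_rectilinearCardy : RectilinearCardy → HalfPlaneWiredCardy :=
  fun h ↦ halfPlaneWiredCardy_of_collinearCardy (collinearCardy_of_rectilinearCardy h)

/-- **Target 9321 is necessary for the conjunct**: `CardyFormulaZ2 → HalfPlaneWiredCardy`. [folklore] -/
theorem halfPlaneWiredCardy_of_cardyFormulaZ2 : _root_.CardyFormulaZ2 → HalfPlaneWiredCardy :=
  fun h ↦ halfPlaneWiredCardy_of_rectilinearCardy fun R _ ↦ h R

end Summit.CriticalPhenomena.CardyFormulaZ2.Cruxes.HalfPlaneMarkDensityLaw.SketchLine
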